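import Mathlib
import Literature.MathematicalPhysics.QuantumFieldTheory.YangMillsOS
import HarnessLib

/-!
# The van Enter–Shlosman representations of `SU(2)` (crux `TubeZeroFreeChannel`, stub R)

Helper file for the crux `TubeZeroFreeChannel` (item `stmt-QuantumFields-18841`, route
`ComplexCouplingChannel` of `QuantumFields/YangMills`), line `legendre-capped-pocket`, stub R
(`stub_vesRep`).  PURE finite-dimensional linear algebra: the CONSTRUCTION, for every `p ≥ 1`, of a
faithful continuous unitary lattice representation `r_p` of `SU(2)` whose Wilson action
`r.N − Re tr r(U)` is the nonlinear plaquette action `8^p · (1 − ((1 + Re tr U / 2)/2)^p)` of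
van Enter–Shlosman (Commun. Math. Phys. 255 (2005) 21–32; only this algebraic identity is used
here, no result of that paper).

Construction (stated as existence theorems with characterising equations, so that the file
introduces no new definitions).
* One factor (`exists_vesFactor`): `B(U) = 𝟙₄ ⊕ U ⊕ Ū` on the index type
  `Fin 4 ⊕ (Fin 2 ⊕ Fin 2)` (`Matrix.fromBlocks`; `Ū = U.map conj` the complex-conjugate
  representation), a monoid homomorphism with `tr B(U) = 4 + tr U + conj (tr U) = 4 + 2 Re tr U`,
  `B(U)ᴴ = B(U⁻¹)`, continuous, injective, and with the entry `B(U) (inl 0) (inl 0) = 1`.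
* Tensor powers in one shot (`exists_tensorPowRep`): for any matrix representation `B` on an
  index type `ι`, the `p`-fold Kronecker power on multi-indices `Fin p → ι`,
  `B^{⊗p}(U) i j = ∏ₖ B(U) (i k) (j k)`; multiplicativity is `∏ₖ ∑ₘ = ∑_{m : Fin p → ι} ∏ₖ`
  (`Fintype.prod_sum`), the trace is `(tr B(U))^p` (`Fintype.sum_pow`), `star` and continuity
  are entrywise, and faithfulness for `p ≥ 1` is read off the entries at the multi-indices
  `(x, x₀, …, x₀)`, `(y, x₀, …, x₀)` with `B(U) x₀ x₀ = 1`.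
* `stub_vesRep`: the `(q+1)`-st tensor power of the factor, reindexed to `Fin (8^(q+1))`
  (`Fintype.equivFinOfCardEq`, `Matrix.reindexRingEquiv`); `N = 8^(q+1)`,
  `tr r(U) = (4 + 2 Re tr U)^(q+1)`, and `8^p − (4 + 2a)^p = 8^p (1 − ((1 + a/2)/2)^p)`.

Everything below is standard finite-dimensional representation bookkeeping and tagged folklore.
-/

set_option autoImplicit false

noncomputable section

open scoped BigOperators ComplexConjugate Matrix
open Literature.MathematicalPhysics.QuantumFieldTheory (LatticeRep)

namespace Summit.QuantumFields.YangMills.Theorems.TubeZeroFreeChannel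

/-! ### Tensor powers of a matrix representation on multi-indices -/

section TensorPow

variable {G : Type*} [Group G] {ι : Type*} [Fintype ι] [DecidableEq ι]

/-- **Tensor powers exist.**  For a matrix representation `B : G →* M_ι(ℂ)` and `p : ℕ` there is a
monoid homomorphism `T : G →* M_{Fin p → ι}(ℂ)` (the `p`-fold Kronecker power on multi-indices)
with entries `T U i j = ∏ₖ B U (i k) (j k)`; multiplicativity is `∏ₖ ∑ₘ = ∑_{m : Fin p → ι} ∏ₖ`.
[folklore] -/
theorem exists_tensorPowRep (B : G →* Matrix ι ι ℂ) (p : ℕ) :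
    ∃ T : G →* Matrix (Fin p → ι) (Fin p → ι) ℂ, ∀ U i j, T U i j = ∏ k, B U (i k) (j k) := by
  refine ⟨{ toFun := fun U => Matrix.of fun i j => ∏ k, B U (i k) (j k)
            map_one' := ?_
            map_mul' := ?_ }, fun _ _ _ => rfl⟩
  · ext i j
    simp only [map_one, Matrix.of_apply]
    by_cases h : i = j
    · subst h
      simp
    · obtain ⟨k, hk⟩ := Function.ne_iff.mp h
      rw [Matrix.one_apply_ne h]
      exact Finset.prod_eq_zero (Finset.mem_univ k) (Matrix.one_apply_ne hk)
  · intro U V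
    ext i j
    simp only [map_mul, Matrix.of_apply, Matrix.mul_apply]
    rw [Fintype.prod_sum]
    simp only [Finset.prod_mul_distrib]

variable {B : G →* Matrix ι ι ℂ} {p : ℕ}

/-- The character of a tensor power is the power of the character:
`tr B^{⊗p}(U) = (tr B(U))^p`. [folklore] -/
theorem trace_tensorPow {T : G →* Matrix (Fin p → ι) (Fin p → ι) ℂ}
    (hT : ∀ U i j, T U i j = ∏ k, B U (i k) (j k)) (U : G) :
    (T U).trace = (B U).trace ^ p := by
  simp only [Matrix.trace, Matrix.diag_apply, hT]
  exact (Fintype.sum_pow (fun x => B U x x) p).symm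

/-- If `B(U)ᴴ = B(U⁻¹)` for all `U` (e.g. `B` unitary), the same holds for a tensor power. [folklore] -/
theorem star_tensorPow {T : G →* Matrix (Fin p → ι) (Fin p → ι) ℂ}
    (hT : ∀ U i j, T U i j = ∏ k, B U (i k) (j k)) (hB : ∀ U, star (B U) = B U⁻¹) (U : G) :
    star (T U) = T U⁻¹ := by
  ext i j
  simp only [Matrix.star_apply, hT, star_prod]
  refine Finset.prod_congr rfl fun k _ => ?_
  rw [← Matrix.star_apply, hB]

/-- A matrix-valued monoid homomorphism on a group with `(f U)ᴴ = f (U⁻¹)` takes values in the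
unitary group. [folklore] -/
theorem mem_unitaryGroup_of_star_eq {n : Type*} [Fintype n] [DecidableEq n]
    (f : G →* Matrix n n ℂ) (hf : ∀ U, star (f U) = f U⁻¹) (U : G) :
    f U ∈ Matrix.unitaryGroup n ℂ :=
  Matrix.mem_unitaryGroup_iff.mpr (by rw [hf, ← map_mul, mul_inv_cancel, map_one])

/-- A tensor power of a continuous matrix representation is continuous (its entries are finite
products of entries). [folklore] -/
theorem continuous_tensorPow [TopologicalSpace G] {T : G →* Matrix (Fin p → ι) (Fin p → ι) ℂ}
    (hT : ∀ U i j, T U i j = ∏ k, B U (i k) (j k)) (hB : Continuous B) : Continuous T :=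
  continuous_matrix fun i j => by
    simp only [hT]
    exact continuous_finsetProd _ fun k _ => hB.matrix_elem (i k) (j k)

/-- Faithfulness of positive tensor powers: if `B` is injective and has an entry `B(U) x₀ x₀ = 1`
for all `U`, then `B^{⊗(p+1)}` is injective (read off the entries at the multi-indices
`(x, x₀, …, x₀)`, `(y, x₀, …, x₀)`). [folklore] -/
theorem tensorPow_succ_injective {T : G →* Matrix (Fin (p + 1) → ι) (Fin (p + 1) → ι) ℂ}
    (hT : ∀ U i j, T U i j = ∏ k, B U (i k) (j k)) (hB : Function.Injective B) (x₀ : ι)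
    (h₀ : ∀ U, B U x₀ x₀ = 1) : Function.Injective T := by
  intro U V hUV
  apply hB
  ext x y
  have h := congr_fun (congr_fun hUV (Fin.cons x fun _ => x₀ : Fin (p + 1) → ι))
    (Fin.cons y fun _ => x₀ : Fin (p + 1) → ι)
  rw [hT, hT] at h
  simpa [Fin.prod_univ_succ, h₀] using h

end TensorPow

/-! ### Two elementary matrix lemmas -/

/-- The trace of a square block matrix is the sum of the traces of its diagonal blocks. [folklore] -/
theorem trace_fromBlocks_eq {l m : Type*} [Fintype l] [Fintype m] (A : Matrix l l ℂ)
    (B : Matrix l m ℂ) (C : Matrix m l ℂ) (D : Matrix m m ℂ) :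
    (Matrix.fromBlocks A B C D).trace = A.trace + D.trace := by
  simp [Matrix.trace, Fintype.sum_sum_type]

/-- The trace is invariant under reindexing along an equivalence. [folklore] -/
theorem trace_reindex_eq {l m : Type*} [Fintype l] [Fintype m] (e : l ≃ m) (M : Matrix l l ℂ) :
    (Matrix.reindex e e M).trace = M.trace := by
  simp only [Matrix.trace, Matrix.diag_apply, Matrix.reindex_apply, Matrix.submatrix_apply]
  exact e.symm.sum_comp fun i => M i i

/-! ### The one-factor representation `𝟙₄ ⊕ U ⊕ Ū` of `SU(2)` -/

section Factor

/-- **The one-factor representation exists.**  The block matrix `B(U) = 𝟙₄ ⊕ U ⊕ Ū` of `SU(2)`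
on `ℂ⁴ ⊕ (ℂ² ⊕ ℂ²)` (trivial ⊕ fundamental ⊕ complex-conjugate representation) is a monoid
homomorphism into matrices indexed by `Fin 4 ⊕ (Fin 2 ⊕ Fin 2)`. [folklore] -/
theorem exists_vesFactor :
    ∃ B : Matrix.specialUnitaryGroup (Fin 2) ℂ →*
        Matrix (Fin 4 ⊕ (Fin 2 ⊕ Fin 2)) (Fin 4 ⊕ (Fin 2 ⊕ Fin 2)) ℂ,
      ∀ U, B U = Matrix.fromBlocks 1 0 0 (Matrix.fromBlocks (U : Matrix (Fin 2) (Fin 2) ℂ) 0 0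
        ((U : Matrix (Fin 2) (Fin 2) ℂ).map conj)) := by
  refine ⟨{ toFun := fun U => Matrix.fromBlocks 1 0 0
              (Matrix.fromBlocks (U : Matrix (Fin 2) (Fin 2) ℂ) 0 0
                ((U : Matrix (Fin 2) (Fin 2) ℂ).map conj))
            map_one' := ?_
            map_mul' := ?_ }, fun _ => rfl⟩
  · simp [Matrix.map_one]
  · intro U V
    simp [Matrix.fromBlocks_multiply]

variable {B : Matrix.specialUnitaryGroup (Fin 2) ℂ →*
    Matrix (Fin 4 ⊕ (Fin 2 ⊕ Fin 2)) (Fin 4 ⊕ (Fin 2 ⊕ Fin 2)) ℂ}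
  (hB : ∀ U, B U = Matrix.fromBlocks 1 0 0 (Matrix.fromBlocks (U : Matrix (Fin 2) (Fin 2) ℂ) 0 0
    ((U : Matrix (Fin 2) (Fin 2) ℂ).map conj)))
include hB

/-- The character of the one-factor representation: `tr B(U) = 4 + 2 Re tr U` (a real number).
[folklore] -/
theorem trace_vesFactor (U : Matrix.specialUnitaryGroup (Fin 2) ℂ) :
    (B U).trace = ((4 + 2 * (U : Matrix (Fin 2) (Fin 2) ℂ).trace.re : ℝ) : ℂ) := by
  have hconj : ((U : Matrix (Fin 2) (Fin 2) ℂ).map conj).trace =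
      conj (U : Matrix (Fin 2) (Fin 2) ℂ).trace :=
    (AddMonoidHom.map_trace (starRingEnd ℂ) _).symm
  rw [hB, trace_fromBlocks_eq, trace_fromBlocks_eq, hconj, Complex.add_conj, Matrix.trace_one,
    Fintype.card_fin]
  push_cast
  ring

/-- The one-factor representation intertwines `star` with inversion: `B(U)ᴴ = B(U⁻¹)` (because
`U⁻¹ = Uᴴ` in `SU(2)` and conjugation commutes with `ᴴ`). [folklore] -/
theorem star_vesFactor (U : Matrix.specialUnitaryGroup (Fin 2) ℂ) : star (B U) = B U⁻¹ := by
  have hU : ((U⁻¹ : Matrix.specialUnitaryGroup (Fin 2) ℂ) : Matrix (Fin 2) (Fin 2) ℂ) =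
      star (U : Matrix (Fin 2) (Fin 2) ℂ) := rfl
  have hmap : ∀ M : Matrix (Fin 2) (Fin 2) ℂ, (M.map conj)ᴴ = Mᴴ.map conj := fun M =>
    (Matrix.conjTranspose_map (starRingEnd ℂ) fun _ => rfl).symm
  simp only [hB, hU, Matrix.star_eq_conjTranspose, Matrix.fromBlocks_conjTranspose,
    Matrix.conjTranspose_one, Matrix.conjTranspose_zero, hmap]

/-- The one-factor representation is faithful (its middle block is `U` itself). [folklore] -/
theorem vesFactor_injective : Function.Injective B := by
  intro U V h
  simp only [hB, Matrix.fromBlocks_inj] at h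
  exact Subtype.ext h.2.2.2.1

/-- The entry of the one-factor representation at the first trivial index is `1`. [folklore] -/
theorem vesFactor_apply_inl_zero (U : Matrix.specialUnitaryGroup (Fin 2) ℂ) :
    B U (Sum.inl 0) (Sum.inl 0) = 1 := by
  simp [hB]

/-- The one-factor representation is continuous. [folklore] -/
theorem continuous_vesFactor : Continuous B := by
  rw [show ⇑B = _ from funext hB]
  exact continuous_const.matrix_fromBlocks continuous_const continuous_const
    (continuous_subtype_val.matrix_fromBlocks continuous_const continuous_const
      (continuous_subtype_val.matrix_map Complex.continuous_conj))

end Factor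

/-! ### The stub -/

/-- **STUB R `stub_vesRep`** (line `legendre-capped-pocket` of crux `TubeZeroFreeChannel`).  For every
`p ≥ 1` there is a faithful continuous unitary lattice representation `r` of `SU(2)` whose Wilson
action is the van Enter–Shlosman nonlinear plaquette action:
`r.N − Re tr r(U) = 8^p · (1 − ((1 + Re tr U / 2)/2)^p)`.  Witness: `r_p = (𝟙₄ ⊕ U ⊕ Ū)^{⊗p}`
reindexed to `Fin (8^p)` (`exists_vesFactor`, `exists_tensorPowRep`, `Fintype.equivFinOfCardEq`,
`Matrix.reindexRingEquiv`): `N = 8^p`, `tr r_p(U) = (4 + 2 Re tr U)^p`, and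
`4 + 2a = 8 · ((1 + a/2)/2)`. [folklore] -/
theorem stub_vesRep :
    ∀ p : ℕ, 1 ≤ p → ∃ r : LatticeRep (Matrix.specialUnitaryGroup (Fin 2) ℂ),
      ∀ U : Matrix.specialUnitaryGroup (Fin 2) ℂ,
        (r.N : ℝ) - (r.ρ U).trace.re =
          (8 : ℝ) ^ p * (1 - ((1 + (U : Matrix (Fin 2) (Fin 2) ℂ).trace.re / 2) / 2) ^ p) := by
  intro p hp
  obtain ⟨q, rfl⟩ : ∃ q, p = q + 1 := ⟨p - 1, by omega⟩
  obtain ⟨B, hB⟩ := exists_vesFactor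
  obtain ⟨T, hT⟩ := exists_tensorPowRep B (q + 1)
  -- an enumeration of the `8^(q+1)` multi-indices
  obtain ⟨e⟩ : Nonempty ((Fin (q + 1) → Fin 4 ⊕ (Fin 2 ⊕ Fin 2)) ≃ Fin (8 ^ (q + 1))) :=
    ⟨Fintype.equivFinOfCardEq (by simp)⟩
  -- the reindexed tensor power, as a monoid homomorphism
  obtain ⟨ρ, hρ⟩ : ∃ ρ : Matrix.specialUnitaryGroup (Fin 2) ℂ →*
      Matrix (Fin (8 ^ (q + 1))) (Fin (8 ^ (q + 1))) ℂ, ∀ U, ρ U = Matrix.reindex e e (T U) :=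
    ⟨(Matrix.reindexRingEquiv ℂ e).toMonoidHom.comp T, fun _ => rfl⟩
  have hρ' : ⇑ρ = fun U => Matrix.reindex e e (T U) := funext hρ
  refine ⟨⟨8 ^ (q + 1), ρ, ?_, ?_, ?_⟩, fun U => ?_⟩
  · -- continuity
    rw [hρ']
    exact (continuous_tensorPow hT (continuous_vesFactor hB)).matrix_reindex e e
  · -- faithfulness
    rw [hρ']
    exact (Matrix.reindex e e).injective.comp
      (tensorPow_succ_injective hT (vesFactor_injective hB) (Sum.inl 0)
        (vesFactor_apply_inl_zero hB))
  · -- unitarity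
    refine mem_unitaryGroup_of_star_eq ρ fun V => ?_
    rw [hρ, hρ, ← star_tensorPow hT (star_vesFactor hB), Matrix.star_eq_conjTranspose,
      Matrix.star_eq_conjTranspose, Matrix.conjTranspose_reindex]
  · -- the Wilson action
    show ((8 ^ (q + 1) : ℕ) : ℝ) - (ρ U).trace.re = _
    rw [hρ, trace_reindex_eq, trace_tensorPow hT, trace_vesFactor hB, ← Complex.ofReal_pow,
      Complex.ofReal_re]
    have ha : (4 : ℝ) + 2 * (U : Matrix (Fin 2) (Fin 2) ℂ).trace.re =
        8 * ((1 + (U : Matrix (Fin 2) (Fin 2) ℂ).trace.re / 2) / 2) := by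
      ring
    rw [ha, mul_pow]
    push_cast
    ring

end Summit.QuantumFields.YangMills.Theorems.TubeZeroFreeChannel
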